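import Literature.Barriers.AtomisticToContinuum.CasimirBoxGeneralizedCondensation
import Mathlib.Analysis.SpecialFunctions.Gaussian.GaussianIntegral
import Mathlib.Analysis.SpecialFunctions.Gamma.Basic
import Mathlib.Analysis.SumIntegralComparisons
import Mathlib.Analysis.PSeries

/-!
# Casimir boxes, type I: the ground level carries `ρ - ρ_c` when `α₁ < 1/2` (proofs)

This file discharges the named fact
`Literature.Barriers.AtomisticToContinuum.BoseGas.Casimir.VandenBergLewis1982_typeI`
(Pulé–Zagrebnov 2004, Prop. 2.2 (i), quoting van den Berg–Lewis 1982): for the perfect Bose gas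
in the Dirichlet boxes `Λ_V = ∏_j [0, V^{α_j}]`, `α₁ ≥ α₂ ≥ α₃ > 0`, `∑ α_j = 1`, with `α₁ < 1/2`,
at `β > 0` and `ρ > ρ_c(β)`, for every family of roots `μ_V(ρ)` of the density equation,
`lim V⁻¹⟨N_{(1,1,1)}⟩(μ_V(ρ)) = ρ - ρ_c` and `lim V⁻¹⟨N_n⟩(μ_V(ρ)) = 0` for `n ≠ (1,1,1)`
(`VandenBergLewis1982_typeI_holds`). The second clause is
`tendsto_inv_mul_gcOccupation_of_ne_groundMode` of the statement file; this file proves the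
first. (The sibling file `CasimirBoxGeneralizedCondensationProofs.lean` discharges the
generalized-condensate fact by a lattice Riemann-sum Weyl law; the argument below is independent
of it — deliberately not imported — and entirely one-dimensional.)

## The proof (ours)

Pulé–Zagrebnov state Prop. 2.2 without proof, referring to [BergLew-82, Thm. 1] (not held);
there the limit is obtained from the Weyl law `F_V → F` for the integrated density of states.
Here the Weyl law is replaced by the product structure of the box spectrum, which keeps every
step elementary:
* `⟨N_n⟩(μ) = ∑_{k≥1} e^{-kβ(ε_n-μ)}` (`hasSum_gcOccupation`) and
  `e^{-kβε_n} = ∏_j e^{-k c_j n_j²}`, `c_j = βπ²/(2V^{2α_j})` (`exp_neg_mul_level`), so box sums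
  factor into theta sums `θ(s) = ∑_{m≥1} e^{-sm²}` (`Finset.prod_univ_sum`);
* `√(π/s)/2 - 1 ≤ θ(s) ≤ √(π/s)/2` by comparison with the Gaussian integral (Mathlib's integral
  test, `sum_range_exp_neg_mul_sq_le`, `sub_one_le_tsum_exp_neg_mul_sq_succ`), and
  `∏_j √(π/(kc_j))/2 = V(2πβk)^{-3/2}` (`prod_sqrt_pi_div_eq`, using `∑ α_j = 1`);
* `ρ_c(β) := ∫_0^∞ (√2/2π²)√η (e^{βη}-1)⁻¹ dη = ∑_{k≥1} (2πβk)^{-3/2}` by termwise integration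
  and `Γ(3/2) = √π/2` (`hasSum_criticalDensity`);
* UPPER bound on the excited levels, uniformly in `μ ≤ E₁(V)` (`sum_erase_gcOccupation_le`):
  `∑_{n≠(1,1,1)} e^{-kβ(ε_n-E₁)} = ∏_j(1+a_j(k)) - 1 ≤ a₁a₂a₃ + ∑_j(a_j² + a_j)`,
  `a_j(k) = ∑_{m≥2} e^{-kc_j(m²-1)}`; the cubic term sums to `≤ Vρ_c`, the edges to
  `≤ 2/c_j = O(V^{2α_j})` (`sum_range_sum_pnat_exp_le`), the faces to `O(V^{2α_j(1+η)})` after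
  interpolating the bounds `a_j(k) ≤ √(π/(kc_j))/2` and `a_j(k) ≤ 2/(kc_j)`
  (`sum_range_sq_sum_pnat_exp_le`); all are `o(V)` iff `α₁ < 1/2` (`tendsto_err_div_atTop`);
* `μ ≤ 0 ⇒ ∑_n ⟨N_n⟩(μ) ≤ Vρ_c` (`sum_gcOccupation_le_of_nonpos`), so roots at `ρ > ρ_c` have
  `μ_V(ρ) > 0` (`IsDensityRoot.mu_pos`), whence the LOWER bound on the excited levels from the
  lower Gaussian bound (`sum_range_prod_tsum_sub_le`, `mul_sum_range_prod_max_le`);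
* the density equation `ρV = ⟨N_{(1,1,1)}⟩ + ∑_{n≠(1,1,1)}⟨N_n⟩` then pins `V⁻¹⟨N_{(1,1,1)}⟩`
  between `ρ - ρ_c ∓ o(1)` (`IsDensityRoot.sub_err_le`, `IsDensityRoot.le_sub_sum_add`).

## References

* [PuleZagrebnov2004] J. V. Pulé, V. A. Zagrebnov, *The canonical perfect Bose gas in Casimir
  boxes*, J. Math. Phys. 45 (2004) 3565–3583, arXiv:math-ph/0405043, §1 and Prop. 2.2 (read).
* [VandenbergLewis1982] M. van den Berg, J. T. Lewis, *On generalized condensation in the free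
  boson gas*, Physica A 110 (1982) 550–564, Thm. 1 (PZ's [BergLew-82]; paywalled, not read —
  the proof below is independent of it).
-/

noncomputable section

open Filter Finset Topology MeasureTheory
open scoped BigOperators

namespace Literature.Barriers.AtomisticToContinuum.BoseGas.Casimir

/-! ### One-dimensional toolkit: geometric expansion and Gaussian (theta) sums -/

/-- `1/(e^x - 1) = ∑_{k ≥ 1} e^{-kx}` for `x > 0` (Bose function as a geometric series).
[folklore] -/
theorem hasSum_exp_neg_succ_mul {x : ℝ} (hx : 0 < x) :
    HasSum (fun k : ℕ => Real.exp (-(((k : ℝ) + 1) * x))) (Real.exp x - 1)⁻¹ := by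
  set r := Real.exp (-x) with hr
  have hr0 : 0 < r := Real.exp_pos _
  have hr1 : r < 1 := Real.exp_lt_one_iff.2 (by linarith)
  have h := (hasSum_geometric_of_lt_one hr0.le hr1).mul_left r
  have hrinv : r⁻¹ = Real.exp x := by rw [hr, Real.exp_neg, inv_inv]
  have hval : r * (1 - r)⁻¹ = (Real.exp x - 1)⁻¹ := by
    have : Real.exp x - 1 = r⁻¹ * (1 - r) := by
      rw [mul_sub, mul_one, inv_mul_cancel₀ hr0.ne', hrinv]
    rw [this, mul_inv, inv_inv]
  have hterm : (fun k : ℕ => Real.exp (-(((k : ℝ) + 1) * x))) = fun k => r * r ^ k := by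
    funext k
    rw [← pow_succ', hr, ← Real.exp_nat_mul]
    congr 1
    push_cast
    ring
  rw [hterm, ← hval]
  exact h

/-- The occupation of a level as a geometric series:
`(e^{β(E-μ)} - 1)⁻¹ = ∑_{k≥1} e^{-kβ(E-μ)}` for `μ < E`, `β > 0`. [folklore] -/
theorem hasSum_gcOccupation {β E μ : ℝ} (hβ : 0 < β) (hμ : μ < E) :
    HasSum (fun k : ℕ => Real.exp (-(((k : ℝ) + 1) * (β * (E - μ))))) (gcOccupation β E μ) :=
  hasSum_exp_neg_succ_mul (mul_pos hβ (sub_pos.2 hμ))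

/-- The Gaussian `x ↦ e^{-cx²}` is antitone on `[0, ∞)` for `c > 0`. [folklore] -/
theorem antitoneOn_exp_neg_mul_sq {c : ℝ} (hc : 0 < c) :
    AntitoneOn (fun x : ℝ => Real.exp (-c * x ^ 2)) (Set.Ici 0) := by
  intro x hx y _ hxy
  have hx0 : 0 ≤ x := hx
  exact Real.exp_le_exp.2 (by nlinarith [mul_self_le_mul_self hx0 hxy])

/-- Right-endpoint Riemann sums of the Gaussian lie below its integral:
`∑_{i<N} e^{-c(i+1)²} ≤ ∫_0^∞ e^{-cx²} dx = √(π/c)/2`. [folklore] -/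
theorem sum_range_exp_neg_mul_sq_le {c : ℝ} (hc : 0 < c) (N : ℕ) :
    ∑ i ∈ Finset.range N, Real.exp (-c * ((i : ℝ) + 1) ^ 2) ≤ Real.sqrt (Real.pi / c) / 2 := by
  have h := AntitoneOn.sum_range_le_integral (f := fun x : ℝ => Real.exp (-c * x ^ 2)) (N := N)
    ((antitoneOn_exp_neg_mul_sq hc).mono Set.Icc_subset_Ici_self)
    (integrable_exp_neg_mul_sq hc).integrableOn (fun t _ => (Real.exp_pos _).le)
  rw [integral_gaussian_Ioi] at h
  convert h using 2
  push_cast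
  ring

/-- The theta sum `θ(c) := ∑_{m ≥ 1} e^{-cm²}` is summable. [folklore] -/
theorem summable_exp_neg_mul_sq_succ {c : ℝ} (hc : 0 < c) :
    Summable (fun i : ℕ => Real.exp (-c * ((i : ℝ) + 1) ^ 2)) := by
  have h := AntitoneOn.summable_of_integrableOn_Ioi_zero (f := fun x : ℝ => Real.exp (-c * x ^ 2))
    (antitoneOn_exp_neg_mul_sq hc) (integrable_exp_neg_mul_sq hc).integrableOn
    (fun t _ => (Real.exp_pos _).le)
  have := (summable_nat_add_iff 1).2 h
  simpa only [Nat.cast_add, Nat.cast_one] using this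

/-- Upper theta bound: `θ(c) = ∑_{m≥1} e^{-cm²} ≤ √(π/c)/2`. [folklore] -/
theorem tsum_exp_neg_mul_sq_succ_le {c : ℝ} (hc : 0 < c) :
    ∑' i : ℕ, Real.exp (-c * ((i : ℝ) + 1) ^ 2) ≤ Real.sqrt (Real.pi / c) / 2 :=
  (summable_exp_neg_mul_sq_succ hc).tsum_le_of_sum_range_le
    (fun N => sum_range_exp_neg_mul_sq_le hc N)

/-- Lower theta bound: `θ(c) = ∑_{m≥1} e^{-cm²} ≥ √(π/c)/2 - 1` (integral test from below,
`∫_0^∞ e^{-cx²} ≤ ∑_{m≥0} e^{-cm²} = 1 + θ(c)`). [folklore] -/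
theorem sub_one_le_tsum_exp_neg_mul_sq_succ {c : ℝ} (hc : 0 < c) :
    Real.sqrt (Real.pi / c) / 2 - 1 ≤ ∑' i : ℕ, Real.exp (-c * ((i : ℝ) + 1) ^ 2) := by
  have hs : Summable (fun n : ℕ => Real.exp (-c * (n : ℝ) ^ 2)) :=
    AntitoneOn.summable_of_integrableOn_Ioi_zero (f := fun x : ℝ => Real.exp (-c * x ^ 2))
      (antitoneOn_exp_neg_mul_sq hc) (integrable_exp_neg_mul_sq hc).integrableOn
      (fun t _ => (Real.exp_pos _).le)
  have h := AntitoneOn.integral_le_tsum (f := fun x : ℝ => Real.exp (-c * x ^ 2))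
    (antitoneOn_exp_neg_mul_sq hc) hs (fun t _ => (Real.exp_pos _).le)
  rw [integral_gaussian_Ioi, hs.tsum_eq_zero_add] at h
  have h0 : Real.exp (-c * ((0 : ℕ) : ℝ) ^ 2) = 1 := by simp
  rw [h0] at h
  have : ∑' i : ℕ, Real.exp (-c * (((i + 1 : ℕ) : ℝ)) ^ 2) =
      ∑' i : ℕ, Real.exp (-c * ((i : ℝ) + 1) ^ 2) := by
    congr 1; funext i; push_cast; ring_nf
  linarith [this]


/-! ### The critical density as a series: `ρ_c(β) = ∑_{k≥1} (2πβk)^{-3/2}` -/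

/-- `y^{3/2} = y√y` for `y ≥ 0`. [folklore] -/
theorem rpow_three_halves {y : ℝ} (hy : 0 ≤ y) : y ^ ((3 : ℝ) / 2) = y * Real.sqrt y := by
  rw [show (3 : ℝ) / 2 = 1 + 1 / 2 by norm_num, Real.rpow_add' hy (by norm_num), Real.rpow_one,
    Real.sqrt_eq_rpow]

/-- The terms `(2πβk)^{-3/2} = y√y`, `y = (2πβk)⁻¹`, written with the `p`-series `k^{-3/2}`
factored out. [folklore] -/
theorem rhoTerm_eq {β : ℝ} (hβ : 0 < β) (k : ℕ) :
    (2 * Real.pi * β * ((k : ℝ) + 1))⁻¹ * Real.sqrt ((2 * Real.pi * β * ((k : ℝ) + 1))⁻¹) =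
      (2 * Real.pi * β)⁻¹ * Real.sqrt ((2 * Real.pi * β)⁻¹) *
        (1 / ((k : ℝ) + 1) ^ ((3 : ℝ) / 2)) := by
  have hk : (0 : ℝ) ≤ (k : ℝ) + 1 := by positivity
  have hc : (0 : ℝ) ≤ (2 * Real.pi * β)⁻¹ := by positivity
  rw [one_div, ← Real.inv_rpow hk, rpow_three_halves (inv_nonneg.2 hk), mul_inv,
    Real.sqrt_mul' _ (inv_nonneg.2 hk)]
  ring

/-- The series `∑_k (2πβk)^{-3/2}` converges (`p`-series, `p = 3/2`). [folklore] -/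
theorem summable_rhoTerm {β : ℝ} (hβ : 0 < β) :
    Summable (fun k : ℕ => (2 * Real.pi * β * ((k : ℝ) + 1))⁻¹ *
      Real.sqrt ((2 * Real.pi * β * ((k : ℝ) + 1))⁻¹)) := by
  have h := (summable_nat_add_iff 1).2 (Real.summable_one_div_nat_rpow.2 (by norm_num : (1 : ℝ) < 3 / 2))
  have h' : Summable (fun k : ℕ => 1 / ((k : ℝ) + 1) ^ ((3 : ℝ) / 2)) := by
    simpa only [Nat.cast_add, Nat.cast_one] using h
  refine (h'.mul_left ((2 * Real.pi * β)⁻¹ * Real.sqrt ((2 * Real.pi * β)⁻¹))).congr fun k => ?_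
  rw [rhoTerm_eq hβ]

/-- **The critical density as a series**: with `ρ_c(β) = ∫_0^∞ (√2/2π²) √η (e^{βη}-1)⁻¹ dη`
(`criticalDensity`), `ρ_c(β) = ∑_{k ≥ 1} (2πβk)^{-3/2}` (`= ζ(3/2)/λ_β³`, `λ_β = √(2πβ)`):
expand `(e^{βη}-1)⁻¹ = ∑_k e^{-kβη}` and integrate term by term,
`∫_0^∞ √η e^{-kβη} dη = Γ(3/2)(kβ)^{-3/2}`, `Γ(3/2) = √π/2`. [folklore] -/
theorem hasSum_criticalDensity {β : ℝ} (hβ : 0 < β) :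
    HasSum (fun k : ℕ => (2 * Real.pi * β * ((k : ℝ) + 1))⁻¹ *
      Real.sqrt ((2 * Real.pi * β * ((k : ℝ) + 1))⁻¹)) (criticalDensity β) := by
  set C : ℝ := Real.sqrt 2 / (2 * Real.pi ^ 2) with hC
  have hC0 : 0 ≤ C := by positivity
  set b : ℕ → ℝ := fun k => ((k : ℝ) + 1) * β with hb
  have hb0 : ∀ k, 0 < b k := fun k => mul_pos (by positivity) hβ
  set F : ℕ → ℝ → ℝ := fun k η => C * (η ^ ((3 : ℝ) / 2 - 1) * Real.exp (-(b k * η))) with hF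
  -- integrability and the value of each integral
  have hFint : ∀ k, IntegrableOn (F k) (Set.Ioi 0) := by
    intro k
    have h := integrableOn_rpow_mul_exp_neg_mul_rpow (s := (3 : ℝ) / 2 - 1) (p := 1)
      (by norm_num) le_rfl (hb0 k)
    simp only [Real.rpow_one, neg_mul] at h
    exact h.const_mul C
  have hFval : ∀ k, ∫ η in Set.Ioi 0, F k η =
      C * ((1 / b k) ^ ((3 : ℝ) / 2) * Real.Gamma (3 / 2)) := by
    intro k
    simp only [hF]
    rw [integral_const_mul, Real.integral_rpow_mul_exp_neg_mul_Ioi (by norm_num) (hb0 k)]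
  have hFnn : ∀ k, ∀ η ∈ Set.Ioi (0 : ℝ), 0 ≤ F k η := by
    intro k η hη
    exact mul_nonneg hC0 (mul_nonneg (Real.rpow_nonneg (le_of_lt hη) _) (Real.exp_pos _).le)
  have hnorm : ∀ k, ∫ η in Set.Ioi 0, ‖F k η‖ = ∫ η in Set.Ioi 0, F k η := by
    intro k
    refine setIntegral_congr_fun measurableSet_Ioi fun η hη => ?_
    rw [Real.norm_of_nonneg (hFnn k η hη)]
  -- Gamma(3/2) = √π/2 and the constant
  have hΓ : Real.Gamma (3 / 2) = Real.sqrt Real.pi / 2 := by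
    rw [show (3 : ℝ) / 2 = 1 / 2 + 1 by norm_num, Real.Gamma_add_one (by norm_num),
      Real.Gamma_one_half_eq]
    ring
  have hconst : C * (Real.sqrt Real.pi / 2) = (2 * Real.pi)⁻¹ * Real.sqrt ((2 * Real.pi)⁻¹) := by
    have hπ := Real.pi_pos
    have h2 : Real.sqrt 2 * Real.sqrt 2 = 2 := Real.mul_self_sqrt (by norm_num)
    have hp : Real.sqrt Real.pi * Real.sqrt Real.pi = Real.pi := Real.mul_self_sqrt hπ.le
    have hs2 : 0 < Real.sqrt 2 := Real.sqrt_pos.2 (by norm_num)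
    have hsp : 0 < Real.sqrt Real.pi := Real.sqrt_pos.2 hπ
    rw [Real.sqrt_inv, Real.sqrt_mul (by norm_num : (0:ℝ) ≤ 2) Real.pi, hC]
    field_simp
    nlinarith [h2, hp]
  have hterm : ∀ k, C * ((1 / b k) ^ ((3 : ℝ) / 2) * Real.Gamma (3 / 2)) =
      (2 * Real.pi * β * ((k : ℝ) + 1))⁻¹ * Real.sqrt ((2 * Real.pi * β * ((k : ℝ) + 1))⁻¹) := by
    intro k
    have hy : 0 ≤ 1 / b k := (one_div_pos.2 (hb0 k)).le
    rw [hΓ, rpow_three_halves hy]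
    have hsplit : (2 * Real.pi * β * ((k : ℝ) + 1))⁻¹ = (2 * Real.pi)⁻¹ * (1 / b k) := by
      simp only [hb]
      rw [one_div, ← mul_inv]
      ring
    rw [hsplit, Real.sqrt_mul' _ hy]
    calc C * (1 / b k * Real.sqrt (1 / b k) * (Real.sqrt Real.pi / 2))
        = (C * (Real.sqrt Real.pi / 2)) * (1 / b k * Real.sqrt (1 / b k)) := by ring
      _ = _ := by rw [hconst]; ring
  -- pointwise expansion of the integrand on `(0, ∞)`
  have hpt : ∀ η ∈ Set.Ioi (0 : ℝ), C * Real.sqrt η * (Real.exp (β * η) - 1)⁻¹ = ∑' k, F k η := by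
    intro η hη
    have hη0 : (0 : ℝ) < η := hη
    have h := (hasSum_exp_neg_succ_mul (mul_pos hβ hη0)).mul_left (C * Real.sqrt η)
    rw [← h.tsum_eq]
    refine tsum_congr fun k => ?_
    simp only [hF, hb]
    rw [show (3 : ℝ) / 2 - 1 = 1 / 2 by norm_num, ← Real.sqrt_eq_rpow]
    ring_nf
  -- summability of the integrals and the swap
  have hsum' := summable_rhoTerm hβ
  have hsum : Summable fun k => ∫ η in Set.Ioi 0, ‖F k η‖ := by
    refine hsum'.congr fun k => ?_
    rw [hnorm, hFval, hterm]
  have hρ : criticalDensity β = ∑' k : ℕ, (2 * Real.pi * β * ((k : ℝ) + 1))⁻¹ *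
      Real.sqrt ((2 * Real.pi * β * ((k : ℝ) + 1))⁻¹) := by
    unfold criticalDensity
    rw [setIntegral_congr_fun measurableSet_Ioi hpt,
      ← integral_tsum_of_summable_integral_norm hFint hsum]
    exact tsum_congr fun k => by rw [hFval, hterm]
  rw [hρ]
  exact hsum'.hasSum

/-- `ρ_c(β) = ∑_{k≥1} (2πβk)^{-3/2}` as a `tsum`. [folklore] -/
theorem criticalDensity_eq_tsum {β : ℝ} (hβ : 0 < β) :
    criticalDensity β = ∑' k : ℕ, (2 * Real.pi * β * ((k : ℝ) + 1))⁻¹ *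
      Real.sqrt ((2 * Real.pi * β * ((k : ℝ) + 1))⁻¹) :=
  (hasSum_criticalDensity hβ).tsum_eq.symm

/-- Partial sums of `∑_k (2πβk)^{-3/2}` are bounded by `ρ_c(β)`. [folklore] -/
theorem sum_range_rhoTerm_le_criticalDensity {β : ℝ} (hβ : 0 < β) (K : ℕ) :
    ∑ k ∈ Finset.range K, (2 * Real.pi * β * ((k : ℝ) + 1))⁻¹ *
      Real.sqrt ((2 * Real.pi * β * ((k : ℝ) + 1))⁻¹) ≤ criticalDensity β :=
  sum_le_hasSum (Finset.range K) (fun k _ => by positivity) (hasSum_criticalDensity hβ)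


/-! ### Finite sums over positive integers: reindexing, Gaussian and tail bounds -/

/-- Reindexing a finite set of positive integers `≥ d+1` into a `range`: for `φ ≥ 0`,
`∑_{m ∈ T} φ(m) ≤ ∑_{i < N} φ(i+d+1)` with `N = max T`. [folklore] -/
theorem sum_pnat_le_sum_range {φ : ℕ → ℝ} (hφ : ∀ i, 0 ≤ φ i) (T : Finset ℕ+) (d : ℕ)
    (hd : ∀ m ∈ T, d + 1 ≤ (m : ℕ)) :
    ∑ m ∈ T, φ m ≤ ∑ i ∈ Finset.range (T.sup fun m => (m : ℕ)), φ (i + d + 1) := by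
  classical
  set N := T.sup fun m => (m : ℕ) with hN
  set g : ℕ → ℕ+ := fun i => ⟨i + d + 1, by omega⟩ with hg
  have hginj : Function.Injective g := by
    intro a b h
    have := congrArg (fun p : ℕ+ => (p : ℕ)) h
    simpa [hg] using this
  have hsub : T ⊆ (Finset.range N).image g := by
    intro m hm
    have hmN : (m : ℕ) ≤ N := Finset.le_sup (f := fun m : ℕ+ => (m : ℕ)) hm
    have hdm := hd m hm
    refine Finset.mem_image.2 ⟨(m : ℕ) - (d + 1), Finset.mem_range.2 (by omega), ?_⟩
    apply PNat.eq
    simp only [hg, PNat.mk_coe]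
    omega
  calc ∑ m ∈ T, φ m ≤ ∑ m ∈ (Finset.range N).image g, φ m :=
        Finset.sum_le_sum_of_subset_of_nonneg hsub fun m _ _ => hφ m
    _ = ∑ i ∈ Finset.range N, φ (g i) := Finset.sum_image fun a _ b _ h => hginj h
    _ = ∑ i ∈ Finset.range N, φ (i + d + 1) := by simp [hg]

/-- Gaussian bound over any finite set of positive integers:
`∑_{m ∈ T} e^{-cm²} ≤ √(π/c)/2`. [folklore] -/
theorem sum_pnat_exp_neg_mul_sq_le {c : ℝ} (hc : 0 < c) (T : Finset ℕ+) :
    ∑ m ∈ T, Real.exp (-c * ((m : ℕ) : ℝ) ^ 2) ≤ Real.sqrt (Real.pi / c) / 2 := by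
  have h := sum_pnat_le_sum_range (φ := fun i : ℕ => Real.exp (-c * (i : ℝ) ^ 2))
    (fun i => (Real.exp_pos _).le) T 0 (fun m _ => m.pos)
  refine h.trans ?_
  simpa [Nat.cast_add, Nat.cast_one] using sum_range_exp_neg_mul_sq_le hc _

/-- Shifted Gaussian bound over positive integers `≥ 2` (`m² - 1 ≥ (m-1)²`):
`∑_{m ∈ T, m ≥ 2} e^{-c(m²-1)} ≤ √(π/c)/2`. [folklore] -/
theorem sum_pnat_exp_neg_mul_sq_sub_one_le {c : ℝ} (hc : 0 < c) (T : Finset ℕ+)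
    (hT : ∀ m ∈ T, m ≠ 1) :
    ∑ m ∈ T, Real.exp (-c * (((m : ℕ) : ℝ) ^ 2 - 1)) ≤ Real.sqrt (Real.pi / c) / 2 := by
  have h2 : ∀ m ∈ T, 1 + 1 ≤ (m : ℕ) := fun m hm => by
    have := m.pos
    have hne : (m : ℕ) ≠ 1 := fun h => hT m hm (PNat.coe_eq_one_iff.1 h)
    omega
  have hle : ∀ m ∈ T, Real.exp (-c * (((m : ℕ) : ℝ) ^ 2 - 1)) ≤
      Real.exp (-c * (((m : ℕ) : ℝ) - 1) ^ 2) := by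
    intro m _
    have hm1 : (1 : ℝ) ≤ ((m : ℕ) : ℝ) := by exact_mod_cast m.pos
    exact Real.exp_le_exp.2 (by nlinarith [mul_nonneg hc.le (by linarith : (0 : ℝ) ≤ (m : ℕ) - 1)])
  refine (Finset.sum_le_sum hle).trans ?_
  have h := sum_pnat_le_sum_range (φ := fun i : ℕ => Real.exp (-c * ((i : ℝ) - 1) ^ 2))
    (fun i => (Real.exp_pos _).le) T 1 h2
  refine h.trans ?_
  have := sum_range_exp_neg_mul_sq_le hc (T.sup fun m => (m : ℕ))
  refine le_of_eq_of_le ?_ this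
  refine Finset.sum_congr rfl fun i _ => ?_
  push_cast
  ring_nf

/-- Interpolation between two upper bounds: `a ≤ p`, `a ≤ q` give `a ≤ p^{1-η} q^η`.
[folklore] -/
theorem le_rpow_mul_rpow_of_le_of_le {a p q η : ℝ} (ha : 0 ≤ a) (hp : a ≤ p) (hq : a ≤ q)
    (hη0 : 0 ≤ η) (hη1 : η ≤ 1) : a ≤ p ^ (1 - η) * q ^ η := by
  have h1 : a = a ^ (1 - η) * a ^ η := by
    rw [← Real.rpow_add' ha (by ring_nf; exact one_ne_zero)]
    ring_nf
    exact (Real.rpow_one a).symm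
  rw [h1]
  exact mul_le_mul (Real.rpow_le_rpow ha hp (by linarith)) (Real.rpow_le_rpow ha hq hη0)
    (Real.rpow_nonneg ha _) (Real.rpow_nonneg (ha.trans hp) _)

/-- `∑_{m ∈ T, m ≥ 2} 1/m² ≤ 1` (telescoping with `1/m² ≤ 1/(m-1) - 1/m`). [folklore] -/
theorem sum_pnat_one_div_sq_le_one (T : Finset ℕ+) (hT : ∀ m ∈ T, m ≠ 1) :
    ∑ m ∈ T, 1 / (((m : ℕ) : ℝ)) ^ 2 ≤ 1 := by
  have h2 : ∀ m ∈ T, 1 + 1 ≤ (m : ℕ) := fun m hm => by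
    have := m.pos
    have hne : (m : ℕ) ≠ 1 := fun h => hT m hm (PNat.coe_eq_one_iff.1 h)
    omega
  have h := sum_pnat_le_sum_range (φ := fun i : ℕ => 1 / (i : ℝ) ^ 2) (fun i => by positivity)
    T 1 h2
  refine h.trans ?_
  set N := T.sup fun m => (m : ℕ)
  calc ∑ i ∈ Finset.range N, (1 / (((i + 1 + 1 : ℕ)) : ℝ) ^ 2)
      ≤ ∑ i ∈ Finset.range N, (1 / ((i : ℝ) + 1) - 1 / ((i : ℝ) + 1 + 1)) := by
        refine Finset.sum_le_sum fun i _ => ?_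
        have hi : (0 : ℝ) < (i : ℝ) + 1 := by positivity
        rw [div_sub_div _ _ hi.ne' (by positivity), div_le_div_iff₀ (by positivity) (by positivity)]
        push_cast
        nlinarith
    _ = 1 - 1 / ((N : ℝ) + 1) := by
        have := Finset.sum_range_sub' (fun i : ℕ => 1 / ((i : ℝ) + 1)) N
        push_cast at this
        rw [this]
        norm_num
    _ ≤ 1 := by
        have : (0 : ℝ) ≤ 1 / ((N : ℝ) + 1) := by positivity
        linarith

/-- Tail bound for the shifted exponentials over `m ≥ 2`:
`∑_{m ∈ T} e^{-c(m²-1)} ≤ 2/c` (`e^{-x} ≤ 1/x`, `m²-1 ≥ m²/2`, `∑ 1/m² ≤ 1`). [folklore] -/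
theorem sum_pnat_exp_neg_mul_sq_sub_one_le_div {c : ℝ} (hc : 0 < c) (T : Finset ℕ+)
    (hT : ∀ m ∈ T, m ≠ 1) :
    ∑ m ∈ T, Real.exp (-c * (((m : ℕ) : ℝ) ^ 2 - 1)) ≤ 2 / c := by
  have h2 : ∀ m ∈ T, (2 : ℝ) ≤ ((m : ℕ) : ℝ) := fun m hm => by
    have := m.pos
    have hne : (m : ℕ) ≠ 1 := fun h => hT m hm (PNat.coe_eq_one_iff.1 h)
    exact_mod_cast (show 2 ≤ (m : ℕ) by omega)
  have hle : ∀ m ∈ T, Real.exp (-c * (((m : ℕ) : ℝ) ^ 2 - 1)) ≤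
      2 / c * (1 / (((m : ℕ) : ℝ)) ^ 2) := by
    intro m hm
    have hm2 := h2 m hm
    have hx : 0 < c * ((((m : ℕ) : ℝ)) ^ 2 - 1) := mul_pos hc (by nlinarith)
    have h3 := Real.add_one_le_exp (c * ((((m : ℕ) : ℝ)) ^ 2 - 1))
    have h4 : Real.exp (-c * (((m : ℕ) : ℝ) ^ 2 - 1)) ≤ (c * ((((m : ℕ) : ℝ)) ^ 2 - 1))⁻¹ := by
      rw [neg_mul, Real.exp_neg]
      exact inv_anti₀ hx (by linarith)
    refine h4.trans ?_
    rw [div_mul_div_comm, mul_one, inv_eq_one_div, div_le_div_iff₀ hx (by positivity)]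
    have hm4 : (4 : ℝ) ≤ ((m : ℕ) : ℝ) ^ 2 := by nlinarith
    nlinarith [mul_le_mul_of_nonneg_left hm4 hc.le]
  refine (Finset.sum_le_sum hle).trans ?_
  rw [← Finset.mul_sum]
  calc 2 / c * ∑ m ∈ T, 1 / (((m : ℕ) : ℝ)) ^ 2 ≤ 2 / c * 1 :=
        mul_le_mul_of_nonneg_left (sum_pnat_one_div_sq_le_one T hT) (by positivity)
    _ = 2 / c := mul_one _

/-- **Edge modes**: `∑_{k=1}^{K} ∑_{m ∈ T, m≥2} e^{-kc(m²-1)} ≤ 2/c` — the modes `(m,1,1)` carry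
`O(V^{2α₁}) = o(V)` particles in total when `α₁ < 1/2`
(`∑_k e^{-kx} ≤ 1/(e^x-1) ≤ 1/x`, `x = c(m²-1) ≥ cm²/2`, `∑ 1/m² ≤ 1`). [folklore] -/
theorem sum_range_sum_pnat_exp_le {c : ℝ} (hc : 0 < c) (T : Finset ℕ+)
    (hT : ∀ m ∈ T, m ≠ 1) (K : ℕ) :
    ∑ k ∈ Finset.range K, ∑ m ∈ T,
      Real.exp (-(((k : ℝ) + 1) * c) * ((((m : ℕ) : ℝ)) ^ 2 - 1)) ≤ 2 / c := by
  rw [Finset.sum_comm]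
  have h2 : ∀ m ∈ T, (2 : ℝ) ≤ ((m : ℕ) : ℝ) := fun m hm => by
    have := m.pos
    have hne : (m : ℕ) ≠ 1 := fun h => hT m hm (PNat.coe_eq_one_iff.1 h)
    exact_mod_cast (show 2 ≤ (m : ℕ) by omega)
  have hinner : ∀ m ∈ T, ∑ k ∈ Finset.range K,
      Real.exp (-(((k : ℝ) + 1) * c) * ((((m : ℕ) : ℝ)) ^ 2 - 1)) ≤
        2 / c * (1 / (((m : ℕ) : ℝ)) ^ 2) := by
    intro m hm
    have hm2 := h2 m hm
    have hx : 0 < c * ((((m : ℕ) : ℝ)) ^ 2 - 1) := mul_pos hc (by nlinarith)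
    have hs := sum_le_hasSum (Finset.range K) (fun k _ => (Real.exp_pos _).le)
      (hasSum_exp_neg_succ_mul hx)
    have hs' : ∑ k ∈ Finset.range K,
        Real.exp (-(((k : ℝ) + 1) * c) * ((((m : ℕ) : ℝ)) ^ 2 - 1)) ≤
          (Real.exp (c * ((((m : ℕ) : ℝ)) ^ 2 - 1)) - 1)⁻¹ := by
      refine le_of_eq_of_le (Finset.sum_congr rfl fun k _ => ?_) hs
      ring_nf
    refine hs'.trans ?_
    have h3 := Real.add_one_le_exp (c * ((((m : ℕ) : ℝ)) ^ 2 - 1))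
    calc (Real.exp (c * ((((m : ℕ) : ℝ)) ^ 2 - 1)) - 1)⁻¹
        ≤ (c * ((((m : ℕ) : ℝ)) ^ 2 - 1))⁻¹ := inv_anti₀ hx (by linarith)
      _ ≤ 2 / c * (1 / (((m : ℕ) : ℝ)) ^ 2) := by
          rw [div_mul_div_comm, mul_one, inv_eq_one_div, div_le_div_iff₀ hx (by positivity)]
          have hm4 : (4 : ℝ) ≤ ((m : ℕ) : ℝ) ^ 2 := by nlinarith
          nlinarith [mul_le_mul_of_nonneg_left hm4 hc.le]
  refine (Finset.sum_le_sum hinner).trans ?_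
  rw [← Finset.mul_sum]
  calc 2 / c * ∑ m ∈ T, 1 / (((m : ℕ) : ℝ)) ^ 2 ≤ 2 / c * 1 :=
        mul_le_mul_of_nonneg_left (sum_pnat_one_div_sq_le_one T hT) (by positivity)
    _ = 2 / c := mul_one _


/-- The `p`-series `∑_k k^{-(1+η)}` (from `k = 1`) is summable for `η > 0`. [folklore] -/
theorem summable_succ_rpow_neg {η : ℝ} (hη : 0 < η) :
    Summable (fun k : ℕ => ((k : ℝ) + 1) ^ (-(1 + η))) := by
  have h := (summable_nat_add_iff 1).2 (Real.summable_nat_rpow.2 (by linarith : -(1 + η) < -1))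
  simpa only [Nat.cast_add, Nat.cast_one] using h

/-- **Face modes**: for `0 < η ≤ 1`, `∑_{k=1}^{K} a(k)² ≤ (π/(4c))^{1-η} (4/c²)^η ζ(1+η)`,
where `a(k) = ∑_{m∈T, m≥2} e^{-kc(m²-1)} ≤ min(√(π/(kc))/2, 2/(kc))` (interpolating the two
bounds makes the `k`-sum converge while keeping the growth in `1/c` subquadratic). [folklore] -/
theorem sum_range_sq_sum_pnat_exp_le {c η : ℝ} (hc : 0 < c) (hη0 : 0 < η) (hη1 : η ≤ 1)
    (T : Finset ℕ+) (hT : ∀ m ∈ T, m ≠ 1) (K : ℕ) :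
    ∑ k ∈ Finset.range K, (∑ m ∈ T,
      Real.exp (-(((k : ℝ) + 1) * c) * ((((m : ℕ) : ℝ)) ^ 2 - 1))) ^ 2 ≤
      (Real.pi / (4 * c)) ^ (1 - η) * (4 / c ^ 2) ^ η *
        ∑' k : ℕ, ((k : ℝ) + 1) ^ (-(1 + η)) := by
  have hk : ∀ k : ℕ, (∑ m ∈ T,
      Real.exp (-(((k : ℝ) + 1) * c) * ((((m : ℕ) : ℝ)) ^ 2 - 1))) ^ 2 ≤
      (Real.pi / (4 * c)) ^ (1 - η) * (4 / c ^ 2) ^ η * ((k : ℝ) + 1) ^ (-(1 + η)) := by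
    intro k
    have hκ0 : (0 : ℝ) < (k : ℝ) + 1 := by positivity
    have hκc : 0 < ((k : ℝ) + 1) * c := mul_pos hκ0 hc
    set a := ∑ m ∈ T, Real.exp (-(((k : ℝ) + 1) * c) * ((((m : ℕ) : ℝ)) ^ 2 - 1)) with ha
    have ha0 : 0 ≤ a := Finset.sum_nonneg fun m _ => (Real.exp_pos _).le
    have h1 : a ≤ Real.sqrt (Real.pi / (((k : ℝ) + 1) * c)) / 2 :=
      sum_pnat_exp_neg_mul_sq_sub_one_le hκc T hT
    have h2 : a ≤ 2 / (((k : ℝ) + 1) * c) := sum_pnat_exp_neg_mul_sq_sub_one_le_div hκc T hT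
    have h1' : a ^ 2 ≤ Real.pi / (4 * c) * ((k : ℝ) + 1)⁻¹ := by
      have : a ^ 2 ≤ (Real.sqrt (Real.pi / (((k : ℝ) + 1) * c)) / 2) ^ 2 :=
        pow_le_pow_left₀ ha0 h1 2
      rw [div_pow, Real.sq_sqrt (by positivity)] at this
      refine this.trans (le_of_eq ?_)
      field_simp
      ring
    have h2' : a ^ 2 ≤ 4 / c ^ 2 * (((k : ℝ) + 1)⁻¹) ^ 2 := by
      have : a ^ 2 ≤ (2 / (((k : ℝ) + 1) * c)) ^ 2 := pow_le_pow_left₀ ha0 h2 2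
      refine this.trans (le_of_eq ?_)
      field_simp
      ring
    have h3 := le_rpow_mul_rpow_of_le_of_le (sq_nonneg a) h1' h2' hη0.le hη1
    refine h3.trans (le_of_eq ?_)
    have hκinv : (0 : ℝ) ≤ ((k : ℝ) + 1)⁻¹ := by positivity
    rw [Real.mul_rpow (by positivity) hκinv, Real.mul_rpow (by positivity) (by positivity),
      (Real.rpow_two ((k : ℝ) + 1)⁻¹).symm, ← Real.rpow_mul hκinv]
    have e1 : ((k : ℝ) + 1)⁻¹ ^ (1 - η) * ((k : ℝ) + 1)⁻¹ ^ (2 * η) =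
        ((k : ℝ) + 1) ^ (-(1 + η)) := by
      rw [← Real.rpow_add (inv_pos.2 hκ0), Real.inv_rpow hκ0.le, Real.rpow_neg hκ0.le]
      congr 2
      ring
    calc (Real.pi / (4 * c)) ^ (1 - η) * ((k : ℝ) + 1)⁻¹ ^ (1 - η) *
          ((4 / c ^ 2) ^ η * ((k : ℝ) + 1)⁻¹ ^ (2 * η))
        = (Real.pi / (4 * c)) ^ (1 - η) * (4 / c ^ 2) ^ η *
            (((k : ℝ) + 1)⁻¹ ^ (1 - η) * ((k : ℝ) + 1)⁻¹ ^ (2 * η)) := by ring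
      _ = _ := by rw [e1]
  refine (Finset.sum_le_sum fun k _ => hk k).trans ?_
  rw [← Finset.mul_sum]
  refine mul_le_mul_of_nonneg_left ?_ (by positivity)
  exact (summable_succ_rpow_neg hη0).sum_le_tsum (Finset.range K)
    (fun k _ => Real.rpow_nonneg (by positivity) _)


/-! ### The box spectrum: positivity, the strict gap, and the product structure -/

/-- Levels are positive (`V > 0`); private copy of the sibling file's `level_pos`, kept here to
avoid importing its measure-theoretic dependencies. [cite: PuleZagrebnov2004, §1] -/
private theorem level_pos' (α : Fin 3 → ℝ) {V : ℝ} (hV : 0 < V) (n : Mode) : 0 < level α V n := by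
  unfold level
  refine mul_pos (by positivity) (Finset.sum_pos (fun j _ => ?_) Finset.univ_nonempty)
  have h1 : (0 : ℝ) < ((n j : ℕ) : ℝ) := by exact_mod_cast (n j).pos
  exact div_pos (by positivity) (Real.rpow_pos_of_pos hV _)

/-- Off the ground level the energy is strictly larger (`V > 0`): some `n_j ≥ 2`.
[cite: PuleZagrebnov2004, §1] -/
theorem level_groundMode_lt (α : Fin 3 → ℝ) {V : ℝ} (hV : 0 < V) {n : Mode}
    (hn : n ≠ groundMode) : level α V groundMode < level α V n := by
  obtain ⟨j, hj⟩ : ∃ j, n j ≠ 1 := by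
    by_contra h
    push Not at h
    exact hn (funext fun j => by simpa using h j)
  unfold level
  refine mul_lt_mul_of_pos_left ?_ (by positivity)
  refine Finset.sum_lt_sum (fun i _ => ?_) ⟨j, Finset.mem_univ j, ?_⟩
  · refine div_le_div_of_nonneg_right ?_ (Real.rpow_pos_of_pos hV _).le
    have h1 : (1 : ℝ) ≤ ((n i : ℕ) : ℝ) := by exact_mod_cast (n i).pos
    simp only [groundMode_apply, PNat.one_coe, Nat.cast_one, one_pow]
    nlinarith
  · refine div_lt_div_of_pos_right ?_ (Real.rpow_pos_of_pos hV _)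
    have hne : (n j : ℕ) ≠ 1 := fun h => hj (PNat.coe_eq_one_iff.1 h)
    have h2 : (2 : ℝ) ≤ ((n j : ℕ) : ℝ) := by
      have := (n j).pos
      exact_mod_cast (show 2 ≤ (n j : ℕ) by omega)
    simp only [groundMode_apply, PNat.one_coe, Nat.cast_one, one_pow]
    nlinarith

/-- Product structure of the Boltzmann weights: with `c_j = βπ²/(2V^{2α_j})`,
`e^{-κβε_{n,V}} = ∏_j e^{-κ c_j n_j²}`. [folklore] -/
theorem exp_neg_mul_level (α : Fin 3 → ℝ) (V β κ : ℝ) (n : Mode) :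
    Real.exp (-(κ * (β * (level α V n - 0)))) =
      ∏ j : Fin 3, Real.exp (-(κ * (β * (Real.pi ^ 2 / 2) / V ^ (2 * α j))) *
        (((n j : ℕ) : ℝ)) ^ 2) := by
  simp only [Fin.prod_univ_three]
  rw [← Real.exp_add, ← Real.exp_add]
  congr 1
  simp only [level, Fin.sum_univ_three]
  ring

/-- Product structure of the shifted Boltzmann weights:
`e^{-κβ(ε_{n,V} - E₁(V))} = ∏_j e^{-κ c_j (n_j² - 1)}`. [folklore] -/
theorem exp_neg_mul_level_sub (α : Fin 3 → ℝ) (V β κ : ℝ) (n : Mode) :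
    Real.exp (-(κ * (β * (level α V n - level α V groundMode)))) =
      ∏ j : Fin 3, Real.exp (-(κ * (β * (Real.pi ^ 2 / 2) / V ^ (2 * α j))) *
        ((((n j : ℕ) : ℝ)) ^ 2 - 1)) := by
  simp only [Fin.prod_univ_three]
  rw [← Real.exp_add, ← Real.exp_add]
  congr 1
  simp only [level, Fin.sum_univ_three, groundMode_apply, PNat.one_coe, Nat.cast_one, one_pow]
  ring

/-- The Gaussian normalisation of one edge: `√(π/(κ c_j))/2 = V^{α_j} √((2πβκ)⁻¹)` for
`c_j = βπ²/(2V^{2α_j})` (i.e. `L_j/λ_{κβ}`, `L_j = V^{α_j}`, `λ = √(2πκβ)`). [folklore] -/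
theorem sqrt_pi_div_eq (α : Fin 3 → ℝ) {V β κ : ℝ} (hV : 0 < V) (hβ : 0 < β) (hκ : 0 < κ)
    (j : Fin 3) :
    Real.sqrt (Real.pi / (κ * (β * (Real.pi ^ 2 / 2) / V ^ (2 * α j)))) / 2 =
      V ^ (α j) * Real.sqrt ((2 * Real.pi * β * κ)⁻¹) := by
  have hu : 0 < V ^ (α j) := Real.rpow_pos_of_pos hV _
  have hV2 : V ^ (2 * α j) = (V ^ (α j)) ^ 2 := by
    rw [mul_comm, Real.rpow_mul hV.le, Real.rpow_two]
  have hy : 0 ≤ (2 * Real.pi * β * κ)⁻¹ := by positivity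
  have hπ := Real.pi_pos
  have h : Real.pi / (κ * (β * (Real.pi ^ 2 / 2) / V ^ (2 * α j))) =
      (V ^ (α j) * (2 * Real.sqrt ((2 * Real.pi * β * κ)⁻¹))) ^ 2 := by
    rw [hV2, mul_pow, mul_pow, Real.sq_sqrt hy]
    field_simp
  rw [h, Real.sqrt_sq (by positivity)]
  ring

/-- For Casimir exponents, `∏_j V^{α_j} = V`. [cite: PuleZagrebnov2004, §1] -/
theorem IsCasimirExponent.prod_rpow {α : Fin 3 → ℝ} (hα : IsCasimirExponent α) {V : ℝ}
    (hV : 0 < V) : ∏ j : Fin 3, V ^ (α j) = V := by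
  rw [Fin.prod_univ_three, ← Real.rpow_add hV, ← Real.rpow_add hV, hα.sum_eq_one, Real.rpow_one]

/-- The product of the three Gaussian normalisations is `V (2πβκ)^{-3/2}` (`|Λ_V| = V`).
[folklore] -/
theorem prod_sqrt_pi_div_eq {α : Fin 3 → ℝ} (hα : IsCasimirExponent α) {V β κ : ℝ}
    (hV : 0 < V) (hβ : 0 < β) (hκ : 0 < κ) :
    ∏ j : Fin 3, Real.sqrt (Real.pi / (κ * (β * (Real.pi ^ 2 / 2) / V ^ (2 * α j)))) / 2 =
      V * ((2 * Real.pi * β * κ)⁻¹ * Real.sqrt ((2 * Real.pi * β * κ)⁻¹)) := by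
  have hy : 0 ≤ (2 * Real.pi * β * κ)⁻¹ := by positivity
  simp_rw [sqrt_pi_div_eq α hV hβ hκ]
  rw [Finset.prod_mul_distrib, hα.prod_rpow hV, Fin.prod_univ_three, Real.mul_self_sqrt hy]

/-! ### Below `μ = 0` the box holds at most `ρ_c V` particles (proved) -/

/-- **Finite-volume density at `μ ≤ 0` is below `ρ_c`**: for every finite set of modes,
`∑_{n ∈ S} ⟨N_n⟩(μ) ≤ V ρ_c(β)` when `μ ≤ 0` (Dirichlet boxes, any `V > 0`): expand in `k`,
factor over the edges, and bound each right-endpoint Gaussian Riemann sum by its integral.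
[folklore] -/
theorem sum_gcOccupation_le_of_nonpos {α : Fin 3 → ℝ} (hα : IsCasimirExponent α) {V β μ : ℝ}
    (hV : 0 < V) (hβ : 0 < β) (hμ : μ ≤ 0) (S : Finset Mode) :
    ∑ n ∈ S, gcOccupation β (level α V n) μ ≤ V * criticalDensity β := by
  classical
  set t : Fin 3 → Finset ℕ+ := fun j => S.image fun n => n j with ht
  have hsub : S ⊆ Fintype.piFinset t := by
    intro n hn
    rw [Fintype.mem_piFinset]
    exact fun j => Finset.mem_image_of_mem _ hn
  set P := Fintype.piFinset t with hP
  have h0 : ∀ n, 0 < level α V n := fun n => level_pos' α hV n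
  -- reduce to μ = 0 and to the box P
  have h1 : ∑ n ∈ S, gcOccupation β (level α V n) μ ≤ ∑ n ∈ P, gcOccupation β (level α V n) 0 :=
    calc ∑ n ∈ S, gcOccupation β (level α V n) μ ≤ ∑ n ∈ S, gcOccupation β (level α V n) 0 :=
          Finset.sum_le_sum fun n _ => gcOccupation_mono_mu hβ hμ (h0 n)
      _ ≤ ∑ n ∈ P, gcOccupation β (level α V n) 0 :=
          Finset.sum_le_sum_of_subset_of_nonneg hsub fun n _ _ => (gcOccupation_pos hβ (h0 n)).le
  refine h1.trans ?_
  -- expand in k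
  have hhas : HasSum (fun k : ℕ => ∑ n ∈ P, Real.exp (-(((k : ℝ) + 1) * (β * (level α V n - 0)))))
      (∑ n ∈ P, gcOccupation β (level α V n) 0) :=
    hasSum_sum fun n _ => hasSum_gcOccupation hβ (h0 n)
  refine le_of_tendsto' hhas.tendsto_sum_nat fun K => ?_
  -- factor each k-term over the edges and bound by Gaussian integrals
  have hk : ∀ k : ℕ, ∑ n ∈ P, Real.exp (-(((k : ℝ) + 1) * (β * (level α V n - 0)))) ≤
      V * ((2 * Real.pi * β * ((k : ℝ) + 1))⁻¹ * Real.sqrt ((2 * Real.pi * β * ((k : ℝ) + 1))⁻¹)) := by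
    intro k
    have hκ : (0 : ℝ) < (k : ℝ) + 1 := by positivity
    simp_rw [exp_neg_mul_level α V β]
    rw [hP, ← Finset.prod_univ_sum t (fun j (m : ℕ+) =>
      Real.exp (-(((k : ℝ) + 1) * (β * (Real.pi ^ 2 / 2) / V ^ (2 * α j))) * (((m : ℕ) : ℝ)) ^ 2)),
      ← prod_sqrt_pi_div_eq hα hV hβ hκ]
    refine Finset.prod_le_prod (fun j _ => Finset.sum_nonneg fun m _ => (Real.exp_pos _).le)
      fun j _ => ?_
    have hc : 0 < ((k : ℝ) + 1) * (β * (Real.pi ^ 2 / 2) / V ^ (2 * α j)) :=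
      mul_pos hκ (div_pos (by positivity) (Real.rpow_pos_of_pos hV _))
    exact sum_pnat_exp_neg_mul_sq_le hc (t j)
  calc ∑ k ∈ Finset.range K, ∑ n ∈ P, Real.exp (-(((k : ℝ) + 1) * (β * (level α V n - 0))))
      ≤ ∑ k ∈ Finset.range K, V * ((2 * Real.pi * β * ((k : ℝ) + 1))⁻¹ *
          Real.sqrt ((2 * Real.pi * β * ((k : ℝ) + 1))⁻¹)) := Finset.sum_le_sum fun k _ => hk k
    _ = V * ∑ k ∈ Finset.range K, ((2 * Real.pi * β * ((k : ℝ) + 1))⁻¹ *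
          Real.sqrt ((2 * Real.pi * β * ((k : ℝ) + 1))⁻¹)) := by rw [Finset.mul_sum]
    _ ≤ V * criticalDensity β :=
        mul_le_mul_of_nonneg_left (sum_range_rhoTerm_le_criticalDensity hβ K) hV.le

/-- **Roots of the density equation are positive above `ρ_c`**: if `ρ > ρ_c(β)` and
`μ = μ_V(ρ)` solves `∑_n ⟨N_n⟩(μ) = ρV` (`V > 0`), then `μ > 0` (so `μ̄_V = μ - E₁(V) > -E₁(V)`).
[cite: PuleZagrebnov2004, Prop. 2.1 (ρ > ρ_c)] (this finite-volume form, [folklore]) -/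
theorem IsDensityRoot.mu_pos {α : Fin 3 → ℝ} (hα : IsCasimirExponent α) {V β ρ μ : ℝ}
    (hV : 0 < V) (hβ : 0 < β) (hρ : criticalDensity β < ρ) (h : IsDensityRoot α β ρ V μ) :
    0 < μ := by
  by_contra hle
  push Not at hle
  have := hasSum_le_of_sum_le h.2 fun S => sum_gcOccupation_le_of_nonpos hα hV hβ hle S
  nlinarith


/-! ### The excited levels hold at most `ρ_c V + o(V)` particles, uniformly in `μ < E₁(V)` -/

/-- The `k`-th shifted Boltzmann sum over a box of modes minus its ground mode factors as
`∏_j (1 + a_j(k)) - 1`, `a_j(k) = ∑_{m ∈ t_j, m ≥ 2} e^{-κ c_j (m²-1)}`. [folklore] -/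
theorem sum_piFinset_erase_exp_eq (α : Fin 3 → ℝ) (V β κ : ℝ) (t : Fin 3 → Finset ℕ+)
    (ht : ∀ j, 1 ∈ t j) :
    ∑ n ∈ (Fintype.piFinset t).erase groundMode,
      Real.exp (-(κ * (β * (level α V n - level α V groundMode)))) =
      ∏ j : Fin 3, (1 + ∑ m ∈ (t j).erase 1,
        Real.exp (-(κ * (β * (Real.pi ^ 2 / 2) / V ^ (2 * α j))) * ((((m : ℕ) : ℝ)) ^ 2 - 1))) - 1 := by
  classical
  have hmem : groundMode ∈ Fintype.piFinset t := Fintype.mem_piFinset.2 fun j => ht j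
  rw [Finset.sum_erase_eq_sub hmem]
  simp_rw [exp_neg_mul_level_sub α V β κ]
  rw [← Finset.prod_univ_sum t (fun j (m : ℕ+) =>
    Real.exp (-(κ * (β * (Real.pi ^ 2 / 2) / V ^ (2 * α j))) * ((((m : ℕ) : ℝ)) ^ 2 - 1)))]
  have hg : ∏ j : Fin 3, Real.exp (-(κ * (β * (Real.pi ^ 2 / 2) / V ^ (2 * α j))) *
      ((((groundMode j : ℕ) : ℝ)) ^ 2 - 1)) = 1 := by
    simp
  rw [hg]
  congr 1
  refine Finset.prod_congr rfl fun j _ => ?_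
  rw [← Finset.add_sum_erase (t j) _ (ht j)]
  simp

/-- **Uniform bound on the shifted Boltzmann sums** (the heart of the upper bound): for a box
of modes `∏_j t_j ∋ (1,1,1)`, `V > 0`, `0 < η ≤ 1` and every `K`,
`∑_{k=1}^{K} ∑_{n ≠ (1,1,1)} e^{-kβ(ε_n - E₁)} ≤ Vρ_c + ∑_j [2/c_j + (π/4c_j)^{1-η}(4/c_j²)^η ζ(1+η)]`:
`∏(1+a_j) - 1 ≤ a₁a₂a₃ + ∑_j (a_j² + a_j)`, the cubic term is bounded by the product of the three
Gaussian integrals `= V(2πβk)^{-3/2}`, the squares (faces) and linear terms (edges) by the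
preceding lemmas. [folklore] -/
theorem sum_range_sum_erase_exp_le {α : Fin 3 → ℝ} (hα : IsCasimirExponent α) {V β η : ℝ}
    (hV : 0 < V) (hβ : 0 < β) (hη0 : 0 < η) (hη1 : η ≤ 1) (t : Fin 3 → Finset ℕ+)
    (ht : ∀ j, 1 ∈ t j) (K : ℕ) :
    ∑ k ∈ Finset.range K, ∑ n ∈ (Fintype.piFinset t).erase groundMode,
      Real.exp (-(((k : ℝ) + 1) * (β * (level α V n - level α V groundMode)))) ≤
      V * criticalDensity β + ∑ j : Fin 3,
        (2 / (β * (Real.pi ^ 2 / 2) / V ^ (2 * α j)) +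
          (Real.pi / (4 * (β * (Real.pi ^ 2 / 2) / V ^ (2 * α j)))) ^ (1 - η) *
            (4 / (β * (Real.pi ^ 2 / 2) / V ^ (2 * α j)) ^ 2) ^ η *
              ∑' k : ℕ, ((k : ℝ) + 1) ^ (-(1 + η))) := by
  classical
  -- notation: c j, a j k
  set c : Fin 3 → ℝ := fun j => β * (Real.pi ^ 2 / 2) / V ^ (2 * α j) with hc
  have hc0 : ∀ j, 0 < c j := fun j => div_pos (by positivity) (Real.rpow_pos_of_pos hV _)
  set a : Fin 3 → ℕ → ℝ := fun j k => ∑ m ∈ (t j).erase 1,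
    Real.exp (-(((k : ℝ) + 1) * c j) * ((((m : ℕ) : ℝ)) ^ 2 - 1)) with ha
  have ha0 : ∀ j k, 0 ≤ a j k := fun j k => Finset.sum_nonneg fun m _ => (Real.exp_pos _).le
  have hT : ∀ j, ∀ m ∈ (t j).erase 1, m ≠ 1 := fun j m hm => Finset.ne_of_mem_erase hm
  -- the k-th term
  have hk : ∀ k : ℕ, ∑ n ∈ (Fintype.piFinset t).erase groundMode,
      Real.exp (-(((k : ℝ) + 1) * (β * (level α V n - level α V groundMode)))) =
      ∏ j, (1 + a j k) - 1 := fun k => sum_piFinset_erase_exp_eq α V β _ t ht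
  simp_rw [hk]
  -- algebra: ∏(1+a_j) - 1 ≤ ∏ a_j + ∑ (a_j² + a_j)
  have hexp : ∀ k, ∏ j, (1 + a j k) - 1 ≤ ∏ j, a j k + ∑ j, (a j k ^ 2 + a j k) := by
    intro k
    simp only [Fin.prod_univ_three, Fin.sum_univ_three]
    nlinarith [ha0 0 k, ha0 1 k, ha0 2 k, sq_nonneg (a 0 k - a 1 k), sq_nonneg (a 0 k - a 2 k),
      sq_nonneg (a 1 k - a 2 k)]
  refine (Finset.sum_le_sum fun k _ => hexp k).trans ?_
  rw [Finset.sum_add_distrib, Finset.sum_comm]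
  refine add_le_add ?_ (Finset.sum_le_sum fun j _ => ?_)
  · -- cubic term: product of the three Gaussian bounds
    have hcub : ∀ k : ℕ, ∏ j, a j k ≤
        V * ((2 * Real.pi * β * ((k : ℝ) + 1))⁻¹ * Real.sqrt ((2 * Real.pi * β * ((k : ℝ) + 1))⁻¹)) := by
      intro k
      have hκ : (0 : ℝ) < (k : ℝ) + 1 := by positivity
      rw [← prod_sqrt_pi_div_eq hα hV hβ hκ]
      refine Finset.prod_le_prod (fun j _ => ha0 j k) fun j _ => ?_
      exact sum_pnat_exp_neg_mul_sq_sub_one_le (mul_pos hκ (hc0 j)) _ (hT j)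
    calc ∑ k ∈ Finset.range K, ∏ j, a j k
        ≤ ∑ k ∈ Finset.range K, V * ((2 * Real.pi * β * ((k : ℝ) + 1))⁻¹ *
            Real.sqrt ((2 * Real.pi * β * ((k : ℝ) + 1))⁻¹)) := Finset.sum_le_sum fun k _ => hcub k
      _ = V * ∑ k ∈ Finset.range K, ((2 * Real.pi * β * ((k : ℝ) + 1))⁻¹ *
            Real.sqrt ((2 * Real.pi * β * ((k : ℝ) + 1))⁻¹)) := by rw [Finset.mul_sum]
      _ ≤ V * criticalDensity β :=
          mul_le_mul_of_nonneg_left (sum_range_rhoTerm_le_criticalDensity hβ K) hV.le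
  · -- faces and edges in direction j
    rw [Finset.sum_add_distrib, add_comm]
    exact add_le_add (sum_range_sum_pnat_exp_le (hc0 j) _ (hT j) K)
      (sum_range_sq_sum_pnat_exp_le (hc0 j) hη0 hη1 _ (hT j) K)

/-- **The excited levels hold at most `ρ_c V + o(V)` particles, uniformly in `μ ≤ E₁(V)`**:
for every finite set `S` of modes and every `μ ≤ E₁(V)`,
`∑_{n ∈ S, n ≠ (1,1,1)} ⟨N_n⟩(μ) ≤ Vρ_c(β) + Err_η(V)` with the explicit error of
`sum_range_sum_erase_exp_le` (which is `o(V)` when `α₁ < 1/2`, see `tendsto_err_div_atTop`).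
[cite: PuleZagrebnov2004, Prop. 2.2 (i)] (this uniform finite-volume form, [folklore]) -/
theorem sum_erase_gcOccupation_le {α : Fin 3 → ℝ} (hα : IsCasimirExponent α) {V β μ η : ℝ}
    (hV : 0 < V) (hβ : 0 < β) (hμ : μ ≤ level α V groundMode) (hη0 : 0 < η) (hη1 : η ≤ 1)
    (S : Finset Mode) :
    ∑ n ∈ S.erase groundMode, gcOccupation β (level α V n) μ ≤
      V * criticalDensity β + ∑ j : Fin 3,
        (2 / (β * (Real.pi ^ 2 / 2) / V ^ (2 * α j)) +
          (Real.pi / (4 * (β * (Real.pi ^ 2 / 2) / V ^ (2 * α j)))) ^ (1 - η) *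
            (4 / (β * (Real.pi ^ 2 / 2) / V ^ (2 * α j)) ^ 2) ^ η *
              ∑' k : ℕ, ((k : ℝ) + 1) ^ (-(1 + η))) := by
  classical
  set t : Fin 3 → Finset ℕ+ := fun j => insert 1 (S.image fun n => n j) with ht
  have ht1 : ∀ j, 1 ∈ t j := fun j => Finset.mem_insert_self _ _
  have hsub : S.erase groundMode ⊆ (Fintype.piFinset t).erase groundMode := by
    intro n hn
    rw [Finset.mem_erase] at hn ⊢
    refine ⟨hn.1, Fintype.mem_piFinset.2 fun j => ?_⟩
    exact Finset.mem_insert_of_mem (Finset.mem_image_of_mem _ hn.2)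
  have hlt : ∀ n ∈ (Fintype.piFinset t).erase groundMode,
      level α V groundMode < level α V n :=
    fun n hn => level_groundMode_lt α hV (Finset.ne_of_mem_erase hn)
  -- monotonicity in μ and in the set
  have h1 : ∑ n ∈ S.erase groundMode, gcOccupation β (level α V n) μ ≤
      ∑ n ∈ (Fintype.piFinset t).erase groundMode,
        gcOccupation β (level α V n) (level α V groundMode) :=
    calc ∑ n ∈ S.erase groundMode, gcOccupation β (level α V n) μ
        ≤ ∑ n ∈ S.erase groundMode, gcOccupation β (level α V n) (level α V groundMode) :=
          Finset.sum_le_sum fun n hn => gcOccupation_mono_mu hβ hμ (hlt n (hsub hn))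
      _ ≤ _ := Finset.sum_le_sum_of_subset_of_nonneg hsub fun n hn _ =>
          (gcOccupation_pos hβ (hlt n hn)).le
  refine h1.trans ?_
  -- expand in k and use the uniform bound
  have hhas : HasSum (fun k : ℕ => ∑ n ∈ (Fintype.piFinset t).erase groundMode,
      Real.exp (-(((k : ℝ) + 1) * (β * (level α V n - level α V groundMode)))))
      (∑ n ∈ (Fintype.piFinset t).erase groundMode,
        gcOccupation β (level α V n) (level α V groundMode)) :=
    hasSum_sum fun n hn => hasSum_gcOccupation hβ (hlt n hn)
  exact le_of_tendsto' hhas.tendsto_sum_nat fun K =>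
    sum_range_sum_erase_exp_le hα hV hβ hη0 hη1 t ht1 K


/-- **The error is `o(V)`**: for `η > 0` with `2α_j(1+η) < 1` for all `j` (such `η` exists iff
`α₁ < 1/2`), `V⁻¹ Err_η(V) → 0`: the edges contribute `O(V^{2α_j})`, the faces
`O(V^{2α_j(1+η)})`. [folklore] -/
theorem tendsto_err_div_atTop {α : Fin 3 → ℝ} (hα : IsCasimirExponent α) {β η : ℝ} (hβ : 0 < β)
    (hη0 : 0 < η) (hη : ∀ j, 2 * α j * (1 + η) < 1) :
    Tendsto (fun V : ℝ => V⁻¹ * ∑ j : Fin 3,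
        (2 / (β * (Real.pi ^ 2 / 2) / V ^ (2 * α j)) +
          (Real.pi / (4 * (β * (Real.pi ^ 2 / 2) / V ^ (2 * α j)))) ^ (1 - η) *
            (4 / (β * (Real.pi ^ 2 / 2) / V ^ (2 * α j)) ^ 2) ^ η *
              ∑' k : ℕ, ((k : ℝ) + 1) ^ (-(1 + η)))) atTop (𝓝 0) := by
  set γ : ℝ := β * (Real.pi ^ 2 / 2) with hγ
  have hγ0 : 0 < γ := by positivity
  set Z : ℝ := ∑' k : ℕ, ((k : ℝ) + 1) ^ (-(1 + η)) with hZ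
  simp_rw [Finset.mul_sum]
  have h : ∀ j : Fin 3, Tendsto (fun V : ℝ => V⁻¹ * (2 / (γ / V ^ (2 * α j)) +
      (Real.pi / (4 * (γ / V ^ (2 * α j)))) ^ (1 - η) * (4 / (γ / V ^ (2 * α j)) ^ 2) ^ η * Z))
      atTop (𝓝 0) := by
    intro j
    have hαj : 0 < α j := hα.pos j
    have h2α : 0 < 1 - 2 * α j := by nlinarith [hη j]
    have he : 0 < 1 - 2 * α j * (1 + η) := by linarith [hη j]
    -- edges
    have h1 : Tendsto (fun V : ℝ => V⁻¹ * (2 / (γ / V ^ (2 * α j)))) atTop (𝓝 0) := by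
      have := (tendsto_rpow_neg_atTop h2α).const_mul (2 / γ)
      rw [mul_zero] at this
      refine this.congr' ?_
      filter_upwards [eventually_gt_atTop 0] with V hV
      rw [Real.rpow_neg hV.le, Real.rpow_sub hV, Real.rpow_one]
      field_simp
    -- faces
    have h2 : Tendsto (fun V : ℝ => V⁻¹ * ((Real.pi / (4 * (γ / V ^ (2 * α j)))) ^ (1 - η) *
        (4 / (γ / V ^ (2 * α j)) ^ 2) ^ η * Z)) atTop (𝓝 0) := by
      have := (tendsto_rpow_neg_atTop he).const_mul
        ((Real.pi / (4 * γ)) ^ (1 - η) * (4 / γ ^ 2) ^ η * Z)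
      rw [mul_zero] at this
      refine this.congr' ?_
      filter_upwards [eventually_gt_atTop 0] with V hV
      have hu : 0 < V ^ (2 * α j) := Real.rpow_pos_of_pos hV _
      have e1 : Real.pi / (4 * (γ / V ^ (2 * α j))) = Real.pi / (4 * γ) * V ^ (2 * α j) := by
        field_simp
      have e2 : 4 / (γ / V ^ (2 * α j)) ^ 2 = 4 / γ ^ 2 * (V ^ (2 * α j)) ^ 2 := by
        field_simp
      rw [e1, e2, Real.mul_rpow (by positivity) hu.le, Real.mul_rpow (by positivity) (by positivity),
        ← Real.rpow_two (V ^ (2 * α j)), ← Real.rpow_mul hV.le, ← Real.rpow_mul hV.le,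
        ← Real.rpow_mul hV.le, ← Real.rpow_neg_one V]
      have hpow : V ^ (-(1 - 2 * α j * (1 + η))) =
          V ^ (-1 : ℝ) * V ^ (2 * α j * (1 - η)) * V ^ (2 * α j * 2 * η) := by
        rw [← Real.rpow_add hV, ← Real.rpow_add hV]
        congr 1
        ring
      rw [hpow]
      ring
    simpa [mul_add] using h1.add h2
  simpa using tendsto_finsetSum Finset.univ fun j _ => h j

/-! ### Lower bound: the excited levels hold at least `ρ_c V - o(V)` particles when `μ ≥ 0` -/

/-- Partial theta-product sums are dominated by the occupations at `μ = 0` of a finite box of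
modes: `∑_{k=1}^{K} ∏_j ∑_{i<N} e^{-k c_j (i+1)²} ≤ ∑_{n ∈ [1,N]³} ⟨N_n⟩(0)`. [folklore] -/
theorem sum_range_prod_sum_range_exp_le (α : Fin 3 → ℝ) {V β : ℝ} (hV : 0 < V) (hβ : 0 < β)
    (K N : ℕ) :
    ∑ k ∈ Finset.range K, ∏ j : Fin 3, ∑ i ∈ Finset.range N,
        Real.exp (-(((k : ℝ) + 1) * (β * (Real.pi ^ 2 / 2) / V ^ (2 * α j))) * ((i : ℝ) + 1) ^ 2) ≤
      ∑ n ∈ Fintype.piFinset (fun _ : Fin 3 => (Finset.range N).image Nat.succPNat),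
        gcOccupation β (level α V n) 0 := by
  classical
  have h0 : ∀ n, (0 : ℝ) < level α V n := fun n => level_pos' α hV n
  have hge : ∀ n ∈ Fintype.piFinset (fun _ : Fin 3 => (Finset.range N).image Nat.succPNat),
      ∑ k ∈ Finset.range K, Real.exp (-(((k : ℝ) + 1) * (β * (level α V n - 0)))) ≤
        gcOccupation β (level α V n) 0 :=
    fun n _ => sum_le_hasSum (Finset.range K) (fun k _ => (Real.exp_pos _).le)
      (hasSum_gcOccupation hβ (h0 n))
  refine le_trans (le_of_eq ?_) (Finset.sum_le_sum hge)
  rw [Finset.sum_comm]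
  refine Finset.sum_congr rfl fun k _ => ?_
  simp_rw [exp_neg_mul_level α V β]
  rw [← Finset.prod_univ_sum (fun _ : Fin 3 => (Finset.range N).image Nat.succPNat)
      (fun j (m : ℕ+) => Real.exp (-(((k : ℝ) + 1) * (β * (Real.pi ^ 2 / 2) / V ^ (2 * α j))) *
        (((m : ℕ) : ℝ)) ^ 2))]
  refine Finset.prod_congr rfl fun j _ => ?_
  rw [Finset.sum_image fun a _ b _ h => Nat.succPNat_injective h]
  refine Finset.sum_congr rfl fun i _ => ?_
  simp [Nat.succPNat_coe]

/-- **Lower bound for the excited levels**: if `0 ≤ μ < E₁(V)` and `e` dominates all finite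
excited sums `∑_{n ∈ S, n ≠ (1,1,1)} ⟨N_n⟩(μ)`, then for every `K`,
`∑_{k=1}^{K} ∏_j θ_j(k) - ⟨N_{(1,1,1)}⟩(0) ≤ e`, `θ_j(k) = ∑_{m ≥ 1} e^{-k c_j m²}`. [folklore] -/
theorem sum_range_prod_tsum_sub_le (α : Fin 3 → ℝ) {V β μ e : ℝ} (hV : 0 < V) (hβ : 0 < β)
    (hμ0 : 0 ≤ μ) (hμ : μ < level α V groundMode)
    (he : ∀ S : Finset Mode, ∑ n ∈ S.erase groundMode, gcOccupation β (level α V n) μ ≤ e)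
    (K : ℕ) :
    ∑ k ∈ Finset.range K, ∏ j : Fin 3, (∑' i : ℕ,
        Real.exp (-(((k : ℝ) + 1) * (β * (Real.pi ^ 2 / 2) / V ^ (2 * α j))) * ((i : ℝ) + 1) ^ 2)) -
      gcOccupation β (level α V groundMode) 0 ≤ e := by
  classical
  have h0 : ∀ n, (0 : ℝ) < level α V n := fun n => level_pos' α hV n
  -- the finite-N version
  have hN : ∀ N : ℕ, ∑ k ∈ Finset.range K, ∏ j : Fin 3, ∑ i ∈ Finset.range N,
      Real.exp (-(((k : ℝ) + 1) * (β * (Real.pi ^ 2 / 2) / V ^ (2 * α j))) * ((i : ℝ) + 1) ^ 2) -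
      gcOccupation β (level α V groundMode) 0 ≤ e := by
    intro N
    set P := Fintype.piFinset (fun _ : Fin 3 => (Finset.range N).image Nat.succPNat) with hP
    have h1 := sum_range_prod_sum_range_exp_le α hV hβ K N
    have h2 : ∑ n ∈ P, gcOccupation β (level α V n) 0 ≤
        gcOccupation β (level α V groundMode) 0 +
          ∑ n ∈ P.erase groundMode, gcOccupation β (level α V n) 0 := by
      rw [← Finset.sum_insert (f := fun n => gcOccupation β (level α V n) 0)
        (Finset.notMem_erase groundMode P)]
      exact Finset.sum_le_sum_of_subset_of_nonneg
        (Finset.subset_insert_iff.2 (Finset.Subset.refl _)) fun n _ _ => (gcOccupation_pos hβ (h0 n)).le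
    have h3 : ∑ n ∈ P.erase groundMode, gcOccupation β (level α V n) 0 ≤
        ∑ n ∈ P.erase groundMode, gcOccupation β (level α V n) μ :=
      Finset.sum_le_sum fun n _ => gcOccupation_mono_mu hβ hμ0
        (hμ.trans_le (level_groundMode_le α hV n))
    linarith [he P, h1, h2, h3]
  -- pass to the limit N → ∞
  have hlim : Tendsto (fun N : ℕ => ∑ k ∈ Finset.range K, ∏ j : Fin 3, ∑ i ∈ Finset.range N,
      Real.exp (-(((k : ℝ) + 1) * (β * (Real.pi ^ 2 / 2) / V ^ (2 * α j))) * ((i : ℝ) + 1) ^ 2) -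
      gcOccupation β (level α V groundMode) 0) atTop
      (𝓝 (∑ k ∈ Finset.range K, ∏ j : Fin 3, (∑' i : ℕ,
        Real.exp (-(((k : ℝ) + 1) * (β * (Real.pi ^ 2 / 2) / V ^ (2 * α j))) * ((i : ℝ) + 1) ^ 2)) -
      gcOccupation β (level α V groundMode) 0)) := by
    refine Filter.Tendsto.sub_const ?_ _
    refine tendsto_finsetSum _ fun k _ => tendsto_finsetProd _ fun j _ => ?_
    have hc : 0 < ((k : ℝ) + 1) * (β * (Real.pi ^ 2 / 2) / V ^ (2 * α j)) :=
      mul_pos (by positivity) (div_pos (by positivity) (Real.rpow_pos_of_pos hV _))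
    exact (summable_exp_neg_mul_sq_succ hc).hasSum.tendsto_sum_nat
  exact le_of_tendsto' hlim hN

/-- The theta products dominate `V ∏_j ((2πβk)^{-1/2} - V^{-α_j})₊` (lower Gaussian bound
`θ_j(k) ≥ V^{α_j}(2πβk)^{-1/2} - 1` on each edge). [folklore] -/
theorem mul_sum_range_prod_max_le {α : Fin 3 → ℝ} (hα : IsCasimirExponent α) {V β : ℝ}
    (hV : 0 < V) (hβ : 0 < β) (K : ℕ) :
    V * ∑ k ∈ Finset.range K, ∏ j : Fin 3,
        max (Real.sqrt ((2 * Real.pi * β * ((k : ℝ) + 1))⁻¹) - (V ^ (α j))⁻¹) 0 ≤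
      ∑ k ∈ Finset.range K, ∏ j : Fin 3, (∑' i : ℕ,
        Real.exp (-(((k : ℝ) + 1) * (β * (Real.pi ^ 2 / 2) / V ^ (2 * α j))) * ((i : ℝ) + 1) ^ 2)) := by
  rw [Finset.mul_sum]
  refine Finset.sum_le_sum fun k _ => ?_
  have hκ : (0 : ℝ) < (k : ℝ) + 1 := by positivity
  have key : V * ∏ j : Fin 3,
      max (Real.sqrt ((2 * Real.pi * β * ((k : ℝ) + 1))⁻¹) - (V ^ (α j))⁻¹) 0 =
      ∏ j : Fin 3, (V ^ (α j) *
        max (Real.sqrt ((2 * Real.pi * β * ((k : ℝ) + 1))⁻¹) - (V ^ (α j))⁻¹) 0) := by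
    rw [Finset.prod_mul_distrib, hα.prod_rpow hV]
  rw [key]
  refine Finset.prod_le_prod (fun j _ => mul_nonneg (Real.rpow_pos_of_pos hV _).le (le_max_right _ _))
    fun j _ => ?_
  have hu : 0 < V ^ (α j) := Real.rpow_pos_of_pos hV _
  have hc : 0 < ((k : ℝ) + 1) * (β * (Real.pi ^ 2 / 2) / V ^ (2 * α j)) :=
    mul_pos hκ (div_pos (by positivity) (Real.rpow_pos_of_pos hV _))
  have hθ := sub_one_le_tsum_exp_neg_mul_sq_succ hc
  rw [sqrt_pi_div_eq α hV hβ hκ j] at hθ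
  have hθ0 : 0 ≤ ∑' i : ℕ, Real.exp (-(((k : ℝ) + 1) * (β * (Real.pi ^ 2 / 2) / V ^ (2 * α j))) *
      ((i : ℝ) + 1) ^ 2) := tsum_nonneg fun i => (Real.exp_pos _).le
  rw [mul_max_of_nonneg _ _ hu.le, mul_zero, mul_sub, mul_inv_cancel₀ hu.ne']
  exact max_le hθ hθ0

/-- As `V → ∞`, `∑_{k≤K} ∏_j ((2πβk)^{-1/2} - V^{-α_j})₊ → ∑_{k≤K} (2πβk)^{-3/2}`. [folklore] -/
theorem tendsto_sum_range_prod_max {α : Fin 3 → ℝ} (hα : IsCasimirExponent α) {β : ℝ}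
    (hβ : 0 < β) (K : ℕ) :
    Tendsto (fun V : ℝ => ∑ k ∈ Finset.range K, ∏ j : Fin 3,
        max (Real.sqrt ((2 * Real.pi * β * ((k : ℝ) + 1))⁻¹) - (V ^ (α j))⁻¹) 0) atTop
      (𝓝 (∑ k ∈ Finset.range K, (2 * Real.pi * β * ((k : ℝ) + 1))⁻¹ *
        Real.sqrt ((2 * Real.pi * β * ((k : ℝ) + 1))⁻¹))) := by
  refine tendsto_finsetSum _ fun k _ => ?_
  have hy : 0 ≤ (2 * Real.pi * β * ((k : ℝ) + 1))⁻¹ := by positivity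
  have hlim : ∀ j : Fin 3, Tendsto (fun V : ℝ =>
      max (Real.sqrt ((2 * Real.pi * β * ((k : ℝ) + 1))⁻¹) - (V ^ (α j))⁻¹) 0) atTop
      (𝓝 (Real.sqrt ((2 * Real.pi * β * ((k : ℝ) + 1))⁻¹))) := by
    intro j
    have h1 : Tendsto (fun V : ℝ => (V ^ (α j))⁻¹) atTop (𝓝 0) :=
      (tendsto_rpow_atTop (hα.pos j)).inv_tendsto_atTop
    have h2 := ((tendsto_const_nhds (x := Real.sqrt ((2 * Real.pi * β * ((k : ℝ) + 1))⁻¹))).sub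
      h1).max (tendsto_const_nhds (x := (0 : ℝ)))
    rw [sub_zero, max_eq_left (Real.sqrt_nonneg _)] at h2
    exact h2
  have h := tendsto_finsetProd Finset.univ fun j _ => hlim j
  rw [Fin.prod_univ_three, Real.mul_self_sqrt hy] at h
  exact h

/-- The reference occupation of the ground level at `μ = 0` is `o(V)`:
`V⁻¹ (e^{βE₁(V)} - 1)⁻¹ ≤ V⁻¹ (βE₁(V))⁻¹ ≤ (2/βπ²) V^{2α₃ - 1} → 0` (`α₃ ≤ 1/3`). [folklore] -/
theorem tendsto_inv_mul_gcOccupation_groundMode_zero {α : Fin 3 → ℝ} (hα : IsCasimirExponent α)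
    {β : ℝ} (hβ : 0 < β) :
    Tendsto (fun V : ℝ => V⁻¹ * gcOccupation β (level α V groundMode) 0) atTop (𝓝 0) := by
  have h3 : 2 * α 2 < 1 := by linarith [hα.le₂₁, hα.le₃₂, hα.sum_eq_one]
  have hlim : Tendsto (fun V : ℝ => (β * (Real.pi ^ 2 / 2))⁻¹ * (V ^ (2 * α 2) * V⁻¹))
      atTop (𝓝 0) := by
    have h0 : Tendsto (fun V : ℝ => V ^ (-(1 - 2 * α 2))) atTop (𝓝 0) :=
      tendsto_rpow_neg_atTop (by linarith)
    have h1 : Tendsto (fun V : ℝ => V ^ (2 * α 2) * V⁻¹) atTop (𝓝 0) := by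
      refine h0.congr' ?_
      filter_upwards [eventually_gt_atTop (0 : ℝ)] with V hV0
      rw [show -(1 - 2 * α 2) = 2 * α 2 - 1 by ring, Real.rpow_sub_one hV0.ne', div_eq_mul_inv]
    simpa only [mul_zero] using h1.const_mul (β * (Real.pi ^ 2 / 2))⁻¹
  refine squeeze_zero' ?_ ?_ hlim
  · filter_upwards [eventually_gt_atTop 0] with V hV
    exact mul_nonneg (inv_nonneg.2 hV.le) (gcOccupation_pos hβ (level_pos' α hV groundMode)).le
  · filter_upwards [eventually_gt_atTop 0] with V hV
    have hE : β * (Real.pi ^ 2 / 2) / V ^ (2 * α 2) ≤ β * (level α V groundMode - 0) := by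
      rw [sub_zero]
      unfold level
      simp only [groundMode_apply, PNat.one_coe, Nat.cast_one, one_pow]
      rw [show β * (Real.pi ^ 2 / 2) / V ^ (2 * α 2) =
        β * (Real.pi ^ 2 / 2 * (1 / V ^ (2 * α 2))) by ring]
      refine mul_le_mul_of_nonneg_left (mul_le_mul_of_nonneg_left ?_ (by positivity)) hβ.le
      exact Finset.single_le_sum (f := fun j => 1 / V ^ (2 * α j))
        (fun j _ => by positivity) (Finset.mem_univ (2 : Fin 3))
    have h1 : gcOccupation β (level α V groundMode) 0 ≤ (β * (level α V groundMode - 0))⁻¹ :=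
      gcOccupation_le_inv hβ (level_pos' α hV _)
    have h2 : (β * (level α V groundMode - 0))⁻¹ ≤ (β * (Real.pi ^ 2 / 2) / V ^ (2 * α 2))⁻¹ :=
      inv_anti₀ (by positivity) hE
    calc V⁻¹ * gcOccupation β (level α V groundMode) 0
        ≤ V⁻¹ * (β * (Real.pi ^ 2 / 2) / V ^ (2 * α 2))⁻¹ :=
          mul_le_mul_of_nonneg_left (h1.trans h2) (inv_nonneg.2 hV.le)
      _ = (β * (Real.pi ^ 2 / 2))⁻¹ * (V ^ (2 * α 2) * V⁻¹) := by
          rw [inv_div]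
          ring


/-! ### The two finite-volume inequalities for the ground level, and the limit -/

/-- **Ground level from below (finite volume)**: at a root `μ = μ_V(ρ)` of the density equation,
`V⁻¹⟨N_{(1,1,1)}⟩(μ) ≥ ρ - ρ_c - V⁻¹ Err_η(V)` (density equation minus the uniform bound on the
excited levels). [cite: PuleZagrebnov2004, Prop. 2.2 (i)] (finite-volume form, [folklore]) -/
theorem IsDensityRoot.sub_err_le {α : Fin 3 → ℝ} (hα : IsCasimirExponent α) {V β ρ μ η : ℝ}
    (hV : 0 < V) (hβ : 0 < β) (hη0 : 0 < η) (hη1 : η ≤ 1) (h : IsDensityRoot α β ρ V μ) :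
    ρ - criticalDensity β - V⁻¹ * ∑ j : Fin 3,
        (2 / (β * (Real.pi ^ 2 / 2) / V ^ (2 * α j)) +
          (Real.pi / (4 * (β * (Real.pi ^ 2 / 2) / V ^ (2 * α j)))) ^ (1 - η) *
            (4 / (β * (Real.pi ^ 2 / 2) / V ^ (2 * α j)) ^ 2) ^ η *
              ∑' k : ℕ, ((k : ℝ) + 1) ^ (-(1 + η))) ≤
      V⁻¹ * gcOccupation β (level α V groundMode) μ := by
  classical
  obtain ⟨hμE, hhas⟩ := h
  set Err := ∑ j : Fin 3,
        (2 / (β * (Real.pi ^ 2 / 2) / V ^ (2 * α j)) +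
          (Real.pi / (4 * (β * (Real.pi ^ 2 / 2) / V ^ (2 * α j)))) ^ (1 - η) *
            (4 / (β * (Real.pi ^ 2 / 2) / V ^ (2 * α j)) ^ 2) ^ η *
              ∑' k : ℕ, ((k : ℝ) + 1) ^ (-(1 + η))) with hErr
  set g := gcOccupation β (level α V groundMode) μ with hg
  have hle : ρ * V ≤ g + (V * criticalDensity β + Err) := by
    refine hasSum_le_of_sum_le hhas fun S => ?_
    calc ∑ n ∈ S, gcOccupation β (level α V n) μ
        ≤ ∑ n ∈ insert groundMode S, gcOccupation β (level α V n) μ :=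
          Finset.sum_le_sum_of_subset_of_nonneg (Finset.subset_insert _ _) fun n _ _ =>
            (gcOccupation_pos hβ (hμE.trans_le (level_groundMode_le α hV n))).le
      _ = g + ∑ n ∈ (insert groundMode S).erase groundMode, gcOccupation β (level α V n) μ :=
          (Finset.add_sum_erase _ _ (Finset.mem_insert_self _ _)).symm
      _ ≤ g + (V * criticalDensity β + Err) :=
          add_le_add le_rfl (sum_erase_gcOccupation_le hα hV hβ hμE.le hη0 hη1 _)
  have key : ρ - criticalDensity β - V⁻¹ * Err = V⁻¹ * (ρ * V - (V * criticalDensity β + Err)) := by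
    field_simp
    ring
  rw [key]
  exact mul_le_mul_of_nonneg_left (by linarith) (inv_nonneg.2 hV.le)

/-- **Ground level from above (finite volume)**: at a root `μ = μ_V(ρ)` with `ρ > ρ_c`
(so `μ > 0`), for every `K`,
`V⁻¹⟨N_{(1,1,1)}⟩(μ) ≤ ρ - ∑_{k≤K} ∏_j ((2πβk)^{-1/2} - V^{-α_j})₊ + V⁻¹⟨N_{(1,1,1)}⟩(0)`.
[cite: PuleZagrebnov2004, Prop. 2.2 (i)] (finite-volume form, [folklore]) -/
theorem IsDensityRoot.le_sub_sum_add {α : Fin 3 → ℝ} (hα : IsCasimirExponent α) {V β ρ μ : ℝ}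
    (hV : 0 < V) (hβ : 0 < β) (hρ : criticalDensity β < ρ) (h : IsDensityRoot α β ρ V μ)
    (K : ℕ) :
    V⁻¹ * gcOccupation β (level α V groundMode) μ ≤
      ρ - ∑ k ∈ Finset.range K, ∏ j : Fin 3,
          max (Real.sqrt ((2 * Real.pi * β * ((k : ℝ) + 1))⁻¹) - (V ^ (α j))⁻¹) 0 +
        V⁻¹ * gcOccupation β (level α V groundMode) 0 := by
  classical
  have hμ0 : 0 < μ := h.mu_pos hα hV hβ hρ
  obtain ⟨hμE, hhas⟩ := h
  set g := gcOccupation β (level α V groundMode) μ with hg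
  set f₀ := gcOccupation β (level α V groundMode) 0 with hf₀
  set hK := ∑ k ∈ Finset.range K, ∏ j : Fin 3,
    max (Real.sqrt ((2 * Real.pi * β * ((k : ℝ) + 1))⁻¹) - (V ^ (α j))⁻¹) 0 with hhK
  have he : ∀ S : Finset Mode,
      ∑ n ∈ S.erase groundMode, gcOccupation β (level α V n) μ ≤ ρ * V - g := by
    intro S
    have h := sum_le_hasSum (insert groundMode S)
      (fun n _ => (gcOccupation_pos hβ (hμE.trans_le (level_groundMode_le α hV n))).le) hhas
    rw [← Finset.add_sum_erase _ _ (Finset.mem_insert_self groundMode S),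
      Finset.erase_insert_eq_erase] at h
    linarith
  have hL := sum_range_prod_tsum_sub_le α hV hβ hμ0.le hμE he K
  have hθ := mul_sum_range_prod_max_le hα hV hβ K
  have hg' : g ≤ ρ * V - V * hK + f₀ := by linarith
  calc V⁻¹ * g ≤ V⁻¹ * (ρ * V - V * hK + f₀) := mul_le_mul_of_nonneg_left hg' (inv_nonneg.2 hV.le)
    _ = ρ - hK + V⁻¹ * f₀ := by field_simp

/-- **Proposition 2.2 (i) of Pulé–Zagrebnov (van den Berg–Lewis 1982, type I), proved.**
For a Casimir box with `α₁ < 1/2`, `β > 0`, `ρ > ρ_c(β)` and any roots `μ_V(ρ)` of the density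
equation: `V⁻¹⟨N_{(1,1,1)}⟩(μ_V(ρ)) → ρ - ρ_c` and `V⁻¹⟨N_n⟩(μ_V(ρ)) → 0` for `n ≠ (1,1,1)`.
Proof (ours, replacing the Weyl-law limit `F_V → F` of the sources by the product structure of
the box spectrum): expand `⟨N_n⟩ = ∑_k e^{-kβ(ε_n - μ)}`, factor each `k`-term over the three
edges into theta sums `θ(s) = ∑_m e^{-sm²}`, compare them with Gaussian integrals
(`√(π/s)/2 - 1 ≤ θ(s) ≤ √(π/s)/2`), and evaluate `ρ_c = ∑_k (2πβk)^{-3/2}`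
(`hasSum_criticalDensity`). Upper bound on the excited levels uniformly in `μ ≤ E₁(V)`
(`sum_erase_gcOccupation_le`: main term `Vρ_c`, edges `O(V^{2α_j})`, faces
`O(V^{2α_j(1+η)})`, all `o(V)` iff `α₁ < 1/2`); lower bound from `μ_V(ρ) > 0`
(`IsDensityRoot.mu_pos`) and the lower Gaussian bound. The clause `n ≠ (1,1,1)` is
`tendsto_inv_mul_gcOccupation_of_ne_groundMode`. [cite: PuleZagrebnov2004, Prop. 2.2 (i)]
[cite: VandenbergLewis1982, via PuleZagrebnov2004 Prop. 2.2] -/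
theorem VandenBergLewis1982_typeI_holds : VandenBergLewis1982_typeI := by
  intro α hα h12 β hβ ρ hρ μ hroot
  refine ⟨?_, fun n hn => tendsto_inv_mul_gcOccupation_of_ne_groundMode α hα.le_zero h12 hβ μ
    (hroot.mono fun V hV => hV.1) hn⟩
  -- the interpolation exponent η for the face terms
  set η : ℝ := (1 - 2 * α 0) / 2 with hη
  have hη0 : 0 < η := by rw [hη]; linarith
  have hη1 : η ≤ 1 := by rw [hη]; linarith [hα.pos 0]
  have hηj : ∀ j, 2 * α j * (1 + η) < 1 := by
    intro j
    have hj := hα.le_zero j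
    have h0 := hα.pos j
    have h1 : 2 * α j * (1 + η) ≤ 2 * α 0 * (1 + η) := by nlinarith
    have h2 : 2 * α 0 * η < η := by nlinarith
    have h3 : 2 * α 0 + η < 1 := by rw [hη]; linarith
    nlinarith
  rw [tendsto_order]
  constructor
  · -- from below
    intro a ha
    have hE := tendsto_err_div_atTop hα hβ hη0 hηj
    have hev := (tendsto_order.1 hE).2 (ρ - criticalDensity β - a) (by linarith)
    filter_upwards [hroot, hev, eventually_gt_atTop (0 : ℝ)] with V hR hErr hV0
    have h := hR.sub_err_le hα hV0 hβ hη0 hη1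
    linarith
  · -- from above
    intro b hb
    set ε : ℝ := b - (ρ - criticalDensity β) with hε
    have hε0 : 0 < ε := by rw [hε]; linarith
    obtain ⟨K, hK⟩ : ∃ K : ℕ, criticalDensity β - ε / 3 <
        ∑ k ∈ Finset.range K, (2 * Real.pi * β * ((k : ℝ) + 1))⁻¹ *
          Real.sqrt ((2 * Real.pi * β * ((k : ℝ) + 1))⁻¹) :=
      ((tendsto_order.1 (hasSum_criticalDensity hβ).tendsto_sum_nat).1
        (criticalDensity β - ε / 3) (by linarith)).exists
    have hev1 := (tendsto_order.1 (tendsto_sum_range_prod_max hα hβ K)).1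
      (criticalDensity β - 2 * (ε / 3)) (by linarith)
    have hev2 := (tendsto_order.1 (tendsto_inv_mul_gcOccupation_groundMode_zero hα hβ)).2
      (ε / 3) (by linarith)
    filter_upwards [hroot, hev1, hev2, eventually_gt_atTop (0 : ℝ)] with V hR h1 h2 hV0
    have h := hR.le_sub_sum_add hα hV0 hβ hρ K
    linarith

end Literature.Barriers.AtomisticToContinuum.BoseGas.Casimir

namespace Literature.Barriers.AtomisticToContinuum

open BoseGas.Casimir

/-- **Type I assembled, unconditionally**: for a Casimir box with `α₁ < 1/2` at `ρ > ρ_c` the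
ground level `(1,1,1)` alone is macroscopically occupied, with density exactly `ρ - ρ_c > 0`,
for the family of roots `μ_V(ρ)` (which exists, `exists_eventually_isDensityRoot`) — the
"evasion" side of the barrier `CasimirBoxGeneralizedCondensation` (type III for `α₁ > 1/2`).
[cite: PuleZagrebnov2004, Prop. 2.2 (i), (iii)] -/
theorem CasimirBoxGeneralizedCondensation.typeI {α : Fin 3 → ℝ} (hα : IsCasimirExponent α)
    (h12 : α 0 < 1 / 2) {β : ℝ} (hβ : 0 < β) {ρ : ℝ} (hρ : criticalDensity β < ρ) :
    ∃ μ : ℝ → ℝ, (∀ᶠ V : ℝ in atTop, IsDensityRoot α β ρ V (μ V)) ∧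
      Tendsto (fun V : ℝ => V⁻¹ * gcOccupation β (level α V groundMode) (μ V)) atTop
          (𝓝 (ρ - criticalDensity β)) ∧ 0 < ρ - criticalDensity β ∧
        ∀ n : Mode, n ≠ groundMode →
          Tendsto (fun V : ℝ => V⁻¹ * gcOccupation β (level α V n) (μ V)) atTop (𝓝 0) := by
  have hρc : 0 ≤ criticalDensity β := by simpa using sum_range_rhoTerm_le_criticalDensity hβ 0
  obtain ⟨μ, hμ⟩ := exists_eventually_isDensityRoot α hβ (hρc.trans_lt hρ)
  obtain ⟨h1, h2⟩ := VandenBergLewis1982_typeI_holds α hα h12 β hβ ρ hρ μ hμ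
  exact ⟨μ, hμ, h1, sub_pos.2 hρ, h2⟩

end Literature.Barriers.AtomisticToContinuum
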